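import Summits.CriticalPhenomena.PercolationContinuityZ3.Theorems.PercNearOneGluingNoHeavyConstsHardCoreReductionPrelims
import HarnessLib

/-!
# Hard-core reduction of `Consts.HardCoreBHK`, II: the per-vertex recursion for the two-copy counts

builds on p205010 (kernel theorem, internal audit signed; external expert review pending).  Support file (`--supports
stmt-CriticalPhenomena-4575`), lead seat `prim-nh-lead-4575` (gen 105); memo `run/shared/lean/prim/prim-nh-lead-4575/LEAD-GEN105.md` §1(1).
Theorems only; no sorries; standard axioms; default heartbeats.

NORMAL FORM.  For a finite vertex type `V`, a source set `S`, a repelled set `T`, a hard-core set `N`, a folding fibre `(M, u)`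
(`a \ M = u`, second copy `a ∆ M`) and a condition `Φ` on the pair of copies that only depends on the two union clusters
`C_S(a)`, `C_S(a ∆ M)`, put
`K_Φ(T, N, M, u) = #{a | a \ M = u, no w ∈ N joined to S in both copies, S ↮ T in both copies, Φ a (a ∆ M)}`;
both sides of `Consts.HardCoreBHK` are of this shape (`Φ = P(C_S a) ∧ Q(C_S (a ∆ M))`, resp. `P(C_S a) ∧ Q(C_S a)`).

THE RECURSION (all identities hold for every such `Φ`, so for both sides at once):
* `count_split` — a vertex `v ∉ T` with a nonempty block `F ⊆ M` of pairs `s(v, t)`, `t ∈ T`: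
  `K(T, N, M, u) = (#{y ⊆ F} − 1) · K(T ∪ {v}, N, M \ F, u) + K(T, N ∪ {v}, M \ F, u)` — the integer identity
  `c_v = (2^f, 1, 1, 0) = hc_v + (2^f − 1) · rep_v` of the memo: the residue of the repelled set is a HARD-CORE interaction;
* `count_forced` — pairs `s(v, t)` open in both copies (`F ⊆ u`) force `v` to be repelled: `K(T, N, M, u) = K(T ∪ {v}, N, M, u \ F)`;
* `count_inside_M`, `count_inside_u` — a live pair inside `T` is irrelevant and can be deleted;
* `count_isolated` — if no live pair meets `T` (and `S ∩ T = ∅`) the `T`-conditions are automatic: `K(T, …) = K(∅, …)`;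
* `count_eq_zero_of_not_disjoint` — `K = 0` if `S` meets `T`.
[cite: VandenbergHaggstromKahn2005, Thm. 1.1 proof (pp. 3–5), identity (6)]
-/

namespace Summit.CriticalPhenomena.PercolationContinuityZ3.Theorems

open Set Literature.Probability.Percolation
open scoped Classical symmDiff

namespace Consts.HardCoreReduction

/-! ### The per-vertex split of the two-copy counts -/

section Split

variable {V : Type*} [Fintype V]

/-- **PER-VERTEX SPLIT (the integer identity `c_v = hc_v + (2^f − 1)·rep_v` of the reduction, memo §1(1)).**  Two-copy counts of the
shape of `Consts.HardCoreBHK` — fibre `(M, u)`, hard-core set `N`, repelled set `T` on both copies, and a condition `Φ` on the pair of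
configurations that only depends on the two union clusters — satisfy, for a vertex `v` and a nonempty block `F ⊆ M` of pairs `s(v, t)`,
`t ∈ T`:  `K(T, N, M, u) = (#{y ⊆ F} − 1) · K(T ∪ {v}, N, M \ F, u) + K(T, N ∪ {v}, M \ F, u)`.
(For fixed `x = a \ F`: all `#{y ⊆ F}` blocks are compatible when `v` is joined to `S` in neither copy, exactly one when in exactly one
copy, none when in both.) [cite: VandenbergHaggstromKahn2005, Thm. 1.1 proof (pp. 3–5), identity (6)] -/
theorem count_split (S T N : Set V) (Φ : BondConfig V → BondConfig V → Prop)
    (hΦ : ∀ a a' b b' : BondConfig V, (⋃ s ∈ S, openEdgeCluster (a) s) = (⋃ s ∈ S, openEdgeCluster (a') s) → (⋃ s ∈ S, openEdgeCluster (b) s) = (⋃ s ∈ S, openEdgeCluster (b') s) → (Φ a b ↔ Φ a' b'))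
    (M u F : BondConfig V) (huM : Disjoint u M) (hFM : F ⊆ M) (v : V)
    (hF : ∀ e ∈ F, ∃ t ∈ T, e = s(v, t)) (hFne : F.Nonempty) :
    (Finset.univ.filter fun a : BondConfig V => a \ (M) = u ∧ ((∀ w ∈ N, ¬ ((∃ s ∈ S, (openGraph (a)).Reachable s w) ∧ (∃ s ∈ S, (openGraph (a ∆ (M))).Reachable s w))) ∧ (∀ s ∈ S, ∀ t ∈ T, ¬ (openGraph (a)).Reachable s t) ∧ (∀ s ∈ S, ∀ t ∈ T, ¬ (openGraph (a ∆ (M))).Reachable s t) ∧ Φ a (a ∆ (M)))).card =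
      ((Finset.univ.filter fun y : BondConfig V => y ⊆ F).card - 1) *
          (Finset.univ.filter fun a : BondConfig V => a \ (M \ F) = u ∧ ((∀ w ∈ N, ¬ ((∃ s ∈ S, (openGraph (a)).Reachable s w) ∧ (∃ s ∈ S, (openGraph (a ∆ (M \ F))).Reachable s w))) ∧ (∀ s ∈ S, ∀ t ∈ insert v T, ¬ (openGraph (a)).Reachable s t) ∧ (∀ s ∈ S, ∀ t ∈ insert v T, ¬ (openGraph (a ∆ (M \ F))).Reachable s t) ∧ Φ a (a ∆ (M \ F)))).card +
        (Finset.univ.filter fun a : BondConfig V => a \ (M \ F) = u ∧ ((∀ w ∈ insert v N, ¬ ((∃ s ∈ S, (openGraph (a)).Reachable s w) ∧ (∃ s ∈ S, (openGraph (a ∆ (M \ F))).Reachable s w))) ∧ (∀ s ∈ S, ∀ t ∈ T, ¬ (openGraph (a)).Reachable s t) ∧ (∀ s ∈ S, ∀ t ∈ T, ¬ (openGraph (a ∆ (M \ F))).Reachable s t) ∧ Φ a (a ∆ (M \ F)))).card := by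
  classical
  have hFtouch : F ⊆ {e : Sym2 V | ∃ t ∈ T, t ∈ e} := by
    intro e he
    obtain ⟨t, ht, rfl⟩ := hF e he
    exact ⟨t, ht, Sym2.mem_mk_right v t⟩
  have huF : Disjoint u F := huM.mono_right hFM
  -- Step 1: fibre decomposition along `F`
  have step1 := card_filter_fibre_split M u F hFM huF
    (fun a => (∀ w ∈ N, ¬ ((∃ s ∈ S, (openGraph (a)).Reachable s w) ∧ (∃ s ∈ S, (openGraph (a ∆ M)).Reachable s w))) ∧ (∀ s ∈ S, ∀ t ∈ T, ¬ (openGraph (a)).Reachable s t) ∧ (∀ s ∈ S, ∀ t ∈ T, ¬ (openGraph (a ∆ M)).Reachable s t) ∧ Φ a (a ∆ M))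
    (fun x => (∀ w ∈ N, ¬ ((∃ s ∈ S, (openGraph (x)).Reachable s w) ∧ (∃ s ∈ S, (openGraph (x ∆ (M \ F))).Reachable s w))) ∧ (∀ s ∈ S, ∀ t ∈ T, ¬ (openGraph (x)).Reachable s t) ∧ (∀ s ∈ S, ∀ t ∈ T, ¬ (openGraph (x ∆ (M \ F))).Reachable s t) ∧ Φ x (x ∆ (M \ F)))
    (fun x y => ((∃ s ∈ S, (openGraph (x)).Reachable s v) → y = ∅) ∧ ((∃ s ∈ S, (openGraph (x ∆ (M \ F))).Reachable s v) → y = F)) ?_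
  · -- Step 2: evaluate the block counts
    have step2 : ∀ x : BondConfig V,
        (Finset.univ.filter fun y : BondConfig V => y ⊆ F ∧ (((∃ s ∈ S, (openGraph (x)).Reachable s v) → y = ∅) ∧ ((∃ s ∈ S, (openGraph (x ∆ (M \ F))).Reachable s v) → y = F))).card =
          (if (∃ s ∈ S, (openGraph (x)).Reachable s v) then 0 else if (∃ s ∈ S, (openGraph (x ∆ (M \ F))).Reachable s v) then 0 else (Finset.univ.filter fun y : BondConfig V => y ⊆ F).card) +
            (if (∃ s ∈ S, (openGraph (x)).Reachable s v) ∧ (∃ s ∈ S, (openGraph (x ∆ (M \ F))).Reachable s v) then 0 else if (∃ s ∈ S, (openGraph (x)).Reachable s v) ∨ (∃ s ∈ S, (openGraph (x ∆ (M \ F))).Reachable s v) then 1 else 0) :=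
      fun x => by
        convert card_filter_subset_rel F hFne (∃ s ∈ S, (openGraph (x)).Reachable s v)
          (∃ s ∈ S, (openGraph (x ∆ (M \ F))).Reachable s v) using 3 <;> congr 1
    -- Step 3: the two sums are `pF · #neither` and `#exactly-one`
    set X := Finset.univ.filter (fun x : BondConfig V => x \ (M \ F) = u ∧
      ((∀ w ∈ N, ¬ ((∃ s ∈ S, (openGraph (x)).Reachable s w) ∧ (∃ s ∈ S, (openGraph (x ∆ (M \ F))).Reachable s w))) ∧ (∀ s ∈ S, ∀ t ∈ T, ¬ (openGraph (x)).Reachable s t) ∧ (∀ s ∈ S, ∀ t ∈ T, ¬ (openGraph (x ∆ (M \ F))).Reachable s t) ∧ Φ x (x ∆ (M \ F)))) with hX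
    set pF := (Finset.univ.filter fun y : BondConfig V => y ⊆ F).card with hpF
    have hpF1 : 1 ≤ pF := by
      rw [hpF, Nat.one_le_iff_ne_zero, ← Nat.pos_iff_ne_zero, Finset.card_pos]
      exact ⟨∅, Finset.mem_filter.2 ⟨Finset.mem_univ _, Set.empty_subset _⟩⟩
    clear_value pF
    have sumA : (∑ x ∈ X, (if (∃ s ∈ S, (openGraph (x)).Reachable s v) then 0 else if (∃ s ∈ S, (openGraph (x ∆ (M \ F))).Reachable s v) then 0 else pF)) =
        pF * (X.filter fun x => ¬ (∃ s ∈ S, (openGraph (x)).Reachable s v) ∧ ¬ (∃ s ∈ S, (openGraph (x ∆ (M \ F))).Reachable s v)).card := by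
      rw [Finset.card_filter, Finset.mul_sum]
      refine Finset.sum_congr rfl fun x _ => ?_
      by_cases h0 : (∃ s ∈ S, (openGraph (x)).Reachable s v) <;> by_cases h1 : (∃ s ∈ S, (openGraph (x ∆ (M \ F))).Reachable s v) <;> simp [h0, h1]
    have sumB : (∑ x ∈ X, (if (∃ s ∈ S, (openGraph (x)).Reachable s v) ∧ (∃ s ∈ S, (openGraph (x ∆ (M \ F))).Reachable s v) then 0 else if (∃ s ∈ S, (openGraph (x)).Reachable s v) ∨ (∃ s ∈ S, (openGraph (x ∆ (M \ F))).Reachable s v) then 1 else 0)) =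
        (X.filter fun x => ¬ ((∃ s ∈ S, (openGraph (x)).Reachable s v) ∧ (∃ s ∈ S, (openGraph (x ∆ (M \ F))).Reachable s v)) ∧ ((∃ s ∈ S, (openGraph (x)).Reachable s v) ∨ (∃ s ∈ S, (openGraph (x ∆ (M \ F))).Reachable s v))).card := by
      rw [Finset.card_filter]
      refine Finset.sum_congr rfl fun x _ => ?_
      by_cases h0 : (∃ s ∈ S, (openGraph (x)).Reachable s v) <;> by_cases h1 : (∃ s ∈ S, (openGraph (x ∆ (M \ F))).Reachable s v) <;> simp [h0, h1]
    -- Step 4: identify the filtered sets with the two reduced instances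
    have idN : (Finset.univ.filter fun a : BondConfig V => a \ (M \ F) = u ∧ ((∀ w ∈ N, ¬ ((∃ s ∈ S, (openGraph (a)).Reachable s w) ∧ (∃ s ∈ S, (openGraph (a ∆ (M \ F))).Reachable s w))) ∧ (∀ s ∈ S, ∀ t ∈ insert v T, ¬ (openGraph (a)).Reachable s t) ∧ (∀ s ∈ S, ∀ t ∈ insert v T, ¬ (openGraph (a ∆ (M \ F))).Reachable s t) ∧ Φ a (a ∆ (M \ F)))).card =
        (X.filter fun x => ¬ (∃ s ∈ S, (openGraph (x)).Reachable s v) ∧ ¬ (∃ s ∈ S, (openGraph (x ∆ (M \ F))).Reachable s v)).card := by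
      rw [hX, Finset.filter_filter]
      congr 1
      refine Finset.filter_congr fun x _ => ?_
      simp only [Set.mem_insert_iff, forall_eq_or_imp, imp_and, forall_and]
      constructor
      · rintro ⟨hfib, hHC, ⟨hv0, hB0⟩, ⟨hv1, hB1⟩, hΦ'⟩
        exact ⟨⟨hfib, hHC, hB0, hB1, hΦ'⟩, fun ⟨s, hs, h⟩ => hv0 s hs h, fun ⟨s, hs, h⟩ => hv1 s hs h⟩
      · rintro ⟨⟨hfib, hHC, hB0, hB1, hΦ'⟩, hn0, hn1⟩
        exact ⟨hfib, hHC, ⟨fun s hs h => hn0 ⟨s, hs, h⟩, hB0⟩, ⟨fun s hs h => hn1 ⟨s, hs, h⟩, hB1⟩, hΦ'⟩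
    have idH : (Finset.univ.filter fun a : BondConfig V => a \ (M \ F) = u ∧ ((∀ w ∈ insert v N, ¬ ((∃ s ∈ S, (openGraph (a)).Reachable s w) ∧ (∃ s ∈ S, (openGraph (a ∆ (M \ F))).Reachable s w))) ∧ (∀ s ∈ S, ∀ t ∈ T, ¬ (openGraph (a)).Reachable s t) ∧ (∀ s ∈ S, ∀ t ∈ T, ¬ (openGraph (a ∆ (M \ F))).Reachable s t) ∧ Φ a (a ∆ (M \ F)))).card =
        (X.filter fun x => ¬ ((∃ s ∈ S, (openGraph (x)).Reachable s v) ∧ (∃ s ∈ S, (openGraph (x ∆ (M \ F))).Reachable s v))).card := by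
      rw [hX, Finset.filter_filter]
      congr 1
      refine Finset.filter_congr fun x _ => ?_
      simp only [Set.mem_insert_iff, forall_eq_or_imp]
      constructor
      · rintro ⟨hfib, ⟨hv, hHC⟩, hB0, hB1, hΦ'⟩
        exact ⟨⟨hfib, hHC, hB0, hB1, hΦ'⟩, hv⟩
      · rintro ⟨⟨hfib, hHC, hB0, hB1, hΦ'⟩, hv⟩
        exact ⟨hfib, ⟨hv, hHC⟩, hB0, hB1, hΦ'⟩
    have splitH : (X.filter fun x => ¬ ((∃ s ∈ S, (openGraph (x)).Reachable s v) ∧ (∃ s ∈ S, (openGraph (x ∆ (M \ F))).Reachable s v))).card =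
        (X.filter fun x => ¬ (∃ s ∈ S, (openGraph (x)).Reachable s v) ∧ ¬ (∃ s ∈ S, (openGraph (x ∆ (M \ F))).Reachable s v)).card +
          (X.filter fun x => ¬ ((∃ s ∈ S, (openGraph (x)).Reachable s v) ∧ (∃ s ∈ S, (openGraph (x ∆ (M \ F))).Reachable s v)) ∧ ((∃ s ∈ S, (openGraph (x)).Reachable s v) ∨ (∃ s ∈ S, (openGraph (x ∆ (M \ F))).Reachable s v))).card := by
      rw [← Finset.card_union_of_disjoint]
      · congr 1
        ext x
        simp only [Finset.mem_filter, Finset.mem_union]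
        constructor
        · rintro ⟨hx, hn⟩
          by_cases hA : (∃ s ∈ S, (openGraph (x)).Reachable s v)
          · by_cases hB : (∃ s ∈ S, (openGraph (x ∆ (M \ F))).Reachable s v)
            · exact absurd ⟨hA, hB⟩ hn
            · exact Or.inr ⟨hx, hn, Or.inl hA⟩
          · by_cases hB : (∃ s ∈ S, (openGraph (x ∆ (M \ F))).Reachable s v)
            · exact Or.inr ⟨hx, hn, Or.inr hB⟩
            · exact Or.inl ⟨hx, hA, hB⟩
        · rintro (⟨hx, hA, -⟩ | ⟨hx, hn, -⟩)
          · exact ⟨hx, fun h => hA h.1⟩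
          · exact ⟨hx, hn⟩
      · rw [Finset.disjoint_filter]
        intro x _ h1 h2
        exact h2.2.elim h1.1 h1.2
    rw [idN, idH, splitH]
    -- arithmetic in ℕ: pF·a + b = (pF − 1)·a + (a + b)
    have harith : pF * (X.filter fun x => ¬ (∃ s ∈ S, (openGraph (x)).Reachable s v) ∧ ¬ (∃ s ∈ S, (openGraph (x ∆ (M \ F))).Reachable s v)).card =
        (pF - 1) * (X.filter fun x => ¬ (∃ s ∈ S, (openGraph (x)).Reachable s v) ∧ ¬ (∃ s ∈ S, (openGraph (x ∆ (M \ F))).Reachable s v)).card +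
          (X.filter fun x => ¬ (∃ s ∈ S, (openGraph (x)).Reachable s v) ∧ ¬ (∃ s ∈ S, (openGraph (x ∆ (M \ F))).Reachable s v)).card := by
      conv_lhs => rw [← Nat.sub_add_cancel hpF1]
      ring
    -- assemble: the fibre decomposition, the block counts, and the two identifications
    have e0 : (Finset.univ.filter fun a : BondConfig V => a \ (M) = u ∧ ((∀ w ∈ N, ¬ ((∃ s ∈ S, (openGraph (a)).Reachable s w) ∧ (∃ s ∈ S, (openGraph (a ∆ (M))).Reachable s w))) ∧ (∀ s ∈ S, ∀ t ∈ T, ¬ (openGraph (a)).Reachable s t) ∧ (∀ s ∈ S, ∀ t ∈ T, ¬ (openGraph (a ∆ (M))).Reachable s t) ∧ Φ a (a ∆ (M)))).card =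
        ∑ x ∈ X, (Finset.univ.filter fun y : BondConfig V => y ⊆ F ∧ (((∃ s ∈ S, (openGraph (x)).Reachable s v) → y = ∅) ∧ ((∃ s ∈ S, (openGraph (x ∆ (M \ F))).Reachable s v) → y = F))).card := by
      rw [hX]; convert step1 using 3; congr 1
    rw [e0, Finset.sum_congr rfl fun x _ => step2 x, Finset.sum_add_distrib, sumA, sumB]
    omega
  · -- the hypothesis of the fibre decomposition: the percolation content
    intro a ha
    have hx1 : (a ∆ M) \ F = (a \ F) ∆ (M \ F) := symmDiff_sdiff_eq a M F
    have hy1 : (a ∆ M) ∩ F = F \ (a ∩ F) := symmDiff_inter_eq_sdiff_of_subset hFM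
    have key0 := not_reachable_iff_sdiff_star (ω := a) (S := S) (T := T) hF
    have key1 := not_reachable_iff_sdiff_star (ω := a ∆ M) (S := S) (T := T) hF
    rw [hx1, hy1] at key1
    have hyF : a ∩ F ⊆ F := Set.inter_subset_right
    have hempt : F \ (a ∩ F) = ∅ ↔ a ∩ F = F := by
      rw [Set.sdiff_eq_empty]
      exact ⟨fun h => Set.Subset.antisymm hyF h, fun h => h.symm.subset⟩
    constructor
    · rintro ⟨hHC, hB0, hB1, hΦ'⟩
      have hB0' := key0.1 hB0
      have hB1' := key1.1 hB1
      have hR0 : ∀ w, (∃ s ∈ S, (openGraph (a)).Reachable s w) ↔ (∃ s ∈ S, (openGraph (a \ F)).Reachable s w) :=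
        fun w => exists_reachable_iff_sdiff_block hFtouch hB0 hB0'.1 w
      have hR1 : ∀ w, (∃ s ∈ S, (openGraph (a ∆ M)).Reachable s w) ↔ (∃ s ∈ S, (openGraph ((a \ F) ∆ (M \ F))).Reachable s w) := by
        intro w; rw [← hx1]; exact exists_reachable_iff_sdiff_block hFtouch hB1 (hx1 ▸ hB1'.1) w
      have hC0 := iUnion_openEdgeCluster_eq_sdiff_block hFtouch hB0 hB0'.1
      have hC1 : (⋃ s ∈ S, openEdgeCluster (a ∆ M) s) = (⋃ s ∈ S, openEdgeCluster ((a \ F) ∆ (M \ F)) s) := by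
        rw [← hx1]; exact iUnion_openEdgeCluster_eq_sdiff_block hFtouch hB1 (hx1 ▸ hB1'.1)
      refine ⟨⟨fun w hw h => hHC w hw ⟨(hR0 w).2 h.1, (hR1 w).2 h.2⟩, hB0'.1, hB1'.1, (hΦ _ _ _ _ hC0 hC1).1 hΦ'⟩,
        hB0'.2, fun h => hempt.1 (hB1'.2 h)⟩
    · rintro ⟨⟨hHC, hB0x, hB1x, hΦ'⟩, hr0, hr1⟩
      have hB0 : (∀ s ∈ S, ∀ t ∈ T, ¬ (openGraph (a)).Reachable s t) := key0.2 ⟨hB0x, hr0⟩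
      have hB1 : (∀ s ∈ S, ∀ t ∈ T, ¬ (openGraph (a ∆ M)).Reachable s t) := key1.2 ⟨hB1x, fun h => hempt.2 (hr1 h)⟩
      have hR0 : ∀ w, (∃ s ∈ S, (openGraph (a)).Reachable s w) ↔ (∃ s ∈ S, (openGraph (a \ F)).Reachable s w) :=
        fun w => exists_reachable_iff_sdiff_block hFtouch hB0 hB0x w
      have hR1 : ∀ w, (∃ s ∈ S, (openGraph (a ∆ M)).Reachable s w) ↔ (∃ s ∈ S, (openGraph ((a \ F) ∆ (M \ F))).Reachable s w) := by
        intro w; rw [← hx1]; exact exists_reachable_iff_sdiff_block hFtouch hB1 (hx1 ▸ hB1x) w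
      have hC0 := iUnion_openEdgeCluster_eq_sdiff_block hFtouch hB0 hB0x
      have hC1 : (⋃ s ∈ S, openEdgeCluster (a ∆ M) s) = (⋃ s ∈ S, openEdgeCluster ((a \ F) ∆ (M \ F)) s) := by
        rw [← hx1]; exact iUnion_openEdgeCluster_eq_sdiff_block hFtouch hB1 (hx1 ▸ hB1x)
      exact ⟨fun w hw h => hHC w hw ⟨(hR0 w).1 h.1, (hR1 w).1 h.2⟩, hB0, hB1, (hΦ _ _ _ _ hC0 hC1).2 hΦ'⟩

end Split


/-! ### The other cases of the recursion: transfer across a block, forced-open `T`-pairs, pairs inside `T`, isolated `T` -/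

section Cases

variable {V : Type*} [Fintype V]

omit [Fintype V] in
/-- **Transfer of the two-copy condition across a block `F ⊆ touch T`**, given how the `B`-conditions of the two copies translate
(`T ⊆ T'`): the hard core and the cluster condition follow by locality. [folklore] -/
theorem cond_transfer (S T T' N : Set V) (hTT' : T ⊆ T') (Φ : BondConfig V → BondConfig V → Prop)
    (hΦ : ∀ a a' b b' : BondConfig V, (⋃ s ∈ S, openEdgeCluster (a) s) = (⋃ s ∈ S, openEdgeCluster (a') s) → (⋃ s ∈ S, openEdgeCluster (b) s) = (⋃ s ∈ S, openEdgeCluster (b') s) → (Φ a b ↔ Φ a' b'))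
    {a a₁ F : BondConfig V} (hF : F ⊆ {e | ∃ t ∈ T, t ∈ e})
    (hB0 : (∀ s ∈ S, ∀ t ∈ T, ¬ (openGraph (a)).Reachable s t) ↔ (∀ s ∈ S, ∀ t ∈ T', ¬ (openGraph (a \ F)).Reachable s t)) (hB1 : (∀ s ∈ S, ∀ t ∈ T, ¬ (openGraph (a₁)).Reachable s t) ↔ (∀ s ∈ S, ∀ t ∈ T', ¬ (openGraph (a₁ \ F)).Reachable s t)) :
    ((∀ w ∈ N, ¬ ((∃ s ∈ S, (openGraph (a)).Reachable s w) ∧ (∃ s ∈ S, (openGraph (a₁)).Reachable s w))) ∧ (∀ s ∈ S, ∀ t ∈ T, ¬ (openGraph (a)).Reachable s t) ∧ (∀ s ∈ S, ∀ t ∈ T, ¬ (openGraph (a₁)).Reachable s t) ∧ Φ (a) (a₁)) ↔ ((∀ w ∈ N, ¬ ((∃ s ∈ S, (openGraph (a \ F)).Reachable s w) ∧ (∃ s ∈ S, (openGraph (a₁ \ F)).Reachable s w))) ∧ (∀ s ∈ S, ∀ t ∈ T', ¬ (openGraph (a \ F)).Reachable s t) ∧ (∀ s ∈ S, ∀ t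 ∈ T', ¬ (openGraph (a₁ \ F)).Reachable s t) ∧ Φ (a \ F) (a₁ \ F)) := by
  have weak : ∀ {x : BondConfig V}, (∀ s ∈ S, ∀ t ∈ T', ¬ (openGraph (x)).Reachable s t) → (∀ s ∈ S, ∀ t ∈ T, ¬ (openGraph (x)).Reachable s t) :=
    fun h s hs t ht => h s hs t (hTT' ht)
  constructor
  · rintro ⟨hHC, hb0, hb1, hΦ'⟩
    have hb0' := hB0.1 hb0
    have hb1' := hB1.1 hb1
    refine ⟨fun w hw h => hHC w hw ⟨(exists_reachable_iff_sdiff_block hF hb0 (weak hb0') w).2 h.1,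
      (exists_reachable_iff_sdiff_block hF hb1 (weak hb1') w).2 h.2⟩, hb0', hb1', ?_⟩
    exact (hΦ _ _ _ _ (iUnion_openEdgeCluster_eq_sdiff_block hF hb0 (weak hb0'))
      (iUnion_openEdgeCluster_eq_sdiff_block hF hb1 (weak hb1'))).1 hΦ'
  · rintro ⟨hHC, hb0', hb1', hΦ'⟩
    have hb0 := hB0.2 hb0'
    have hb1 := hB1.2 hb1'
    refine ⟨fun w hw h => hHC w hw ⟨(exists_reachable_iff_sdiff_block hF hb0 (weak hb0') w).1 h.1,
      (exists_reachable_iff_sdiff_block hF hb1 (weak hb1') w).1 h.2⟩, hb0, hb1, ?_⟩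
    exact (hΦ _ _ _ _ (iUnion_openEdgeCluster_eq_sdiff_block hF hb0 (weak hb0'))
      (iUnion_openEdgeCluster_eq_sdiff_block hF hb1 (weak hb1'))).2 hΦ'

/-- **FORCED case**: if a nonempty block `F ⊆ u` of pairs `s(v, t)`, `t ∈ T`, is open in BOTH copies, then `v` is joined to `S` in
neither copy, and `K(T, N, M, u) = K(T ∪ {v}, N, M, u \ F)`. [folklore] -/
theorem count_forced (S T N : Set V) (Φ : BondConfig V → BondConfig V → Prop)
    (hΦ : ∀ a a' b b' : BondConfig V, (⋃ s ∈ S, openEdgeCluster (a) s) = (⋃ s ∈ S, openEdgeCluster (a') s) → (⋃ s ∈ S, openEdgeCluster (b) s) = (⋃ s ∈ S, openEdgeCluster (b') s) → (Φ a b ↔ Φ a' b'))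
    (M u F : BondConfig V) (huM : Disjoint u M) (hFu : F ⊆ u) (v : V)
    (hF : ∀ e ∈ F, ∃ t ∈ T, e = s(v, t)) (hFne : F.Nonempty) :
    (Finset.univ.filter fun a : BondConfig V => a \ (M) = u ∧ ((∀ w ∈ N, ¬ ((∃ s ∈ S, (openGraph (a)).Reachable s w) ∧ (∃ s ∈ S, (openGraph (a ∆ (M))).Reachable s w))) ∧ (∀ s ∈ S, ∀ t ∈ T, ¬ (openGraph (a)).Reachable s t) ∧ (∀ s ∈ S, ∀ t ∈ T, ¬ (openGraph (a ∆ (M))).Reachable s t) ∧ Φ (a) (a ∆ (M)))).card = (Finset.univ.filter fun a : BondConfig V => a \ (M) = u \ F ∧ ((∀ w ∈ N, ¬ ((∃ s ∈ S, (openGraph (a)).Reachable s w) ∧ (∃ s ∈ S, (openGraph (a ∆ (M))).Reachable s w))) ∧ (∀ s ∈ S, ∀ t ∈ insert v T, ¬ (openGraph (a)).Reachable s t) ∧ (∀ s ∈ S, ∀ t ∈ insert v T, ¬ (openGraph (a ∆ (M))).Reachable s t) ∧ Φ (a) (a ∆ (M)))).card := by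
  classical
  have hFtouch : F ⊆ {e : Sym2 V | ∃ t ∈ T, t ∈ e} := by
    intro e he; obtain ⟨t, ht, rfl⟩ := hF e he; exact ⟨t, ht, Sym2.mem_mk_right v t⟩
  have hFM : Disjoint F M := huM.mono_left hFu
  suffices key : ∀ a : BondConfig V, a \ M = u →
      (((∀ w ∈ N, ¬ ((∃ s ∈ S, (openGraph (a)).Reachable s w) ∧ (∃ s ∈ S, (openGraph (a ∆ M)).Reachable s w))) ∧ (∀ s ∈ S, ∀ t ∈ T, ¬ (openGraph (a)).Reachable s t) ∧ (∀ s ∈ S, ∀ t ∈ T, ¬ (openGraph (a ∆ M)).Reachable s t) ∧ Φ (a) (a ∆ M)) ↔ ((∀ w ∈ N, ¬ ((∃ s ∈ S, (openGraph (a \ F)).Reachable s w) ∧ (∃ s ∈ S, (openGraph ((a \ F) ∆ M)).Reachable s w))) ∧ (∀ s ∈ S, ∀ t ∈ insert v T, ¬ (openGraph (a \ F)).Reachable s t) ∧ (∀ s ∈ S, ∀ t ∈ insert v T, ¬ (openGraph ((a \ F) ∆ M)).Reachable s t) ∧ Φ (a \ F) ((a \ F) ∆ M))) by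
    have h := card_filter_fibre_forced M u F hFu huM (fun a => ((∀ w ∈ N, ¬ ((∃ s ∈ S, (openGraph (a)).Reachable s w) ∧ (∃ s ∈ S, (openGraph (a ∆ M)).Reachable s w))) ∧ (∀ s ∈ S, ∀ t ∈ T, ¬ (openGraph (a)).Reachable s t) ∧ (∀ s ∈ S, ∀ t ∈ T, ¬ (openGraph (a ∆ M)).Reachable s t) ∧ Φ (a) (a ∆ M)))
      (fun x => ((∀ w ∈ N, ¬ ((∃ s ∈ S, (openGraph (x)).Reachable s w) ∧ (∃ s ∈ S, (openGraph (x ∆ M)).Reachable s w))) ∧ (∀ s ∈ S, ∀ t ∈ insert v T, ¬ (openGraph (x)).Reachable s t) ∧ (∀ s ∈ S, ∀ t ∈ insert v T, ¬ (openGraph (x ∆ M)).Reachable s t) ∧ Φ (x) (x ∆ M))) key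
    convert h using 3
  intro a ha
  have hFa : F ⊆ a := fun e he => by
    have : e ∈ a \ M := by rw [ha]; exact hFu he
    exact this.1
  have hx1 : (a ∆ M) \ F = (a \ F) ∆ M := by
    rw [symmDiff_sdiff_eq, sdiff_eq_left.2 hFM.symm]
  have hFa1 : F ⊆ a ∆ M := fun e he =>
    Set.mem_symmDiff.2 (Or.inl ⟨hFa he, fun heM => Set.disjoint_left.1 hFM he heM⟩)
  obtain ⟨e₀, he₀⟩ := hFne
  have key0 := not_reachable_iff_sdiff_star (ω := a) (S := S) (T := T) hF
  have key1 := not_reachable_iff_sdiff_star (ω := a ∆ M) (S := S) (T := T) hF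
  have hB0 : (∀ s ∈ S, ∀ t ∈ T, ¬ (openGraph (a)).Reachable s t) ↔ (∀ s ∈ S, ∀ t ∈ insert v T, ¬ (openGraph (a \ F)).Reachable s t) := by
    rw [key0]
    simp only [Set.mem_insert_iff, forall_eq_or_imp, imp_and, forall_and]
    constructor
    · rintro ⟨hB, hv⟩
      refine ⟨fun s hs h => ?_, hB⟩
      have h0 := hv ⟨s, hs, h⟩
      have : e₀ ∈ a ∩ F := ⟨hFa he₀, he₀⟩
      rw [h0] at this; exact this
    · rintro ⟨hv, hB⟩; exact ⟨hB, fun ⟨s, hs, h⟩ => (hv s hs h).elim⟩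
  have hB1 : (∀ s ∈ S, ∀ t ∈ T, ¬ (openGraph (a ∆ M)).Reachable s t) ↔ (∀ s ∈ S, ∀ t ∈ insert v T, ¬ (openGraph ((a ∆ M) \ F)).Reachable s t) := by
    rw [key1]
    simp only [Set.mem_insert_iff, forall_eq_or_imp, imp_and, forall_and]
    constructor
    · rintro ⟨hB, hv⟩
      refine ⟨fun s hs h => ?_, hB⟩
      have h0 := hv ⟨s, hs, h⟩
      have : e₀ ∈ (a ∆ M) ∩ F := ⟨hFa1 he₀, he₀⟩
      rw [h0] at this; exact this
    · rintro ⟨hv, hB⟩; exact ⟨hB, fun ⟨s, hs, h⟩ => (hv s hs h).elim⟩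
  have := cond_transfer S T (insert v T) N (Set.subset_insert v T) Φ hΦ hFtouch hB0 hB1
  rw [hx1] at this
  exact this

/-- **Pair INSIDE `T`, split coordinate**: a pair `e ∈ M` with both endpoints in `T` is never used by a cluster of `S` on `{S ↮ T}`, so
`K(T, N, M, u) = #{y ⊆ {e}} · K(T, N, M \ {e}, u)`. [folklore] -/
theorem count_inside_M (S T N : Set V) (Φ : BondConfig V → BondConfig V → Prop)
    (hΦ : ∀ a a' b b' : BondConfig V, (⋃ s ∈ S, openEdgeCluster (a) s) = (⋃ s ∈ S, openEdgeCluster (a') s) → (⋃ s ∈ S, openEdgeCluster (b) s) = (⋃ s ∈ S, openEdgeCluster (b') s) → (Φ a b ↔ Φ a' b'))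
    (M u : BondConfig V) (huM : Disjoint u M) {p q : V} (hp : p ∈ T) (hq : q ∈ T) (he : s(q, p) ∈ M) :
    (Finset.univ.filter fun a : BondConfig V => a \ (M) = u ∧ ((∀ w ∈ N, ¬ ((∃ s ∈ S, (openGraph (a)).Reachable s w) ∧ (∃ s ∈ S, (openGraph (a ∆ (M))).Reachable s w))) ∧ (∀ s ∈ S, ∀ t ∈ T, ¬ (openGraph (a)).Reachable s t) ∧ (∀ s ∈ S, ∀ t ∈ T, ¬ (openGraph (a ∆ (M))).Reachable s t) ∧ Φ (a) (a ∆ (M)))).card =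
      (Finset.univ.filter fun y : BondConfig V => y ⊆ {s(q, p)}).card * (Finset.univ.filter fun a : BondConfig V => a \ (M \ {s(q, p)}) = u ∧ ((∀ w ∈ N, ¬ ((∃ s ∈ S, (openGraph (a)).Reachable s w) ∧ (∃ s ∈ S, (openGraph (a ∆ (M \ {s(q, p)}))).Reachable s w))) ∧ (∀ s ∈ S, ∀ t ∈ T, ¬ (openGraph (a)).Reachable s t) ∧ (∀ s ∈ S, ∀ t ∈ T, ¬ (openGraph (a ∆ (M \ {s(q, p)}))).Reachable s t) ∧ Φ (a) (a ∆ (M \ {s(q, p)})))).card := by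
  classical
  have hF : ∀ e ∈ ({s(q, p)} : Set (Sym2 V)), ∃ t'' ∈ T, e = s(q, t'') := by
    intro e he; rw [Set.mem_singleton_iff] at he; exact ⟨p, hp, he⟩
  have hFtouch : ({s(q, p)} : Set (Sym2 V)) ⊆ {e : Sym2 V | ∃ t ∈ T, t ∈ e} := by
    intro e he; rw [Set.mem_singleton_iff] at he; subst he; exact ⟨p, hp, Sym2.mem_mk_right q p⟩
  have hFM : ({s(q, p)} : Set (Sym2 V)) ⊆ M := Set.singleton_subset_iff.2 he
  have step := card_filter_fibre_split M u {s(q, p)} hFM (huM.mono_right hFM)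
    (fun a => ((∀ w ∈ N, ¬ ((∃ s ∈ S, (openGraph (a)).Reachable s w) ∧ (∃ s ∈ S, (openGraph (a ∆ M)).Reachable s w))) ∧ (∀ s ∈ S, ∀ t ∈ T, ¬ (openGraph (a)).Reachable s t) ∧ (∀ s ∈ S, ∀ t ∈ T, ¬ (openGraph (a ∆ M)).Reachable s t) ∧ Φ (a) (a ∆ M)))
    (fun x => ((∀ w ∈ N, ¬ ((∃ s ∈ S, (openGraph (x)).Reachable s w) ∧ (∃ s ∈ S, (openGraph (x ∆ (M \ {s(q, p)}))).Reachable s w))) ∧ (∀ s ∈ S, ∀ t ∈ T, ¬ (openGraph (x)).Reachable s t) ∧ (∀ s ∈ S, ∀ t ∈ T, ¬ (openGraph (x ∆ (M \ {s(q, p)}))).Reachable s t) ∧ Φ (x) (x ∆ (M \ {s(q, p)}))))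
    (fun _ _ => True) ?_
  · have e1 : (Finset.univ.filter fun a : BondConfig V => a \ (M) = u ∧ ((∀ w ∈ N, ¬ ((∃ s ∈ S, (openGraph (a)).Reachable s w) ∧ (∃ s ∈ S, (openGraph (a ∆ (M))).Reachable s w))) ∧ (∀ s ∈ S, ∀ t ∈ T, ¬ (openGraph (a)).Reachable s t) ∧ (∀ s ∈ S, ∀ t ∈ T, ¬ (openGraph (a ∆ (M))).Reachable s t) ∧ Φ (a) (a ∆ (M)))).card = ∑ x ∈ Finset.univ.filter (fun x : BondConfig V => x \ (M \ {s(q, p)}) = u ∧ ((∀ w ∈ N, ¬ ((∃ s ∈ S, (openGraph (x)).Reachable s w) ∧ (∃ s ∈ S, (openGraph (x ∆ (M \ {s(q, p)}))).Reachable s w))) ∧ (∀ s ∈ S, ∀ t ∈ T, ¬ (openGraph (x)).Reachable s t) ∧ (∀ s ∈ S, ∀ t ∈ T, ¬ (openGraph (x ∆ (M \ {s(q, p)}))).Reachable s t) ∧ Φ (x) (x ∆ (M \ {s(q, p)})))),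
        (Finset.univ.filter fun y : BondConfig V => y ⊆ {s(q, p)} ∧ True).card := by
      convert step using 3; congr 1
    rw [e1]
    simp only [and_true, Finset.sum_const, smul_eq_mul]
    rw [mul_comm]
  · intro a ha
    rw [and_true]
    have hx1 : (a ∆ M) \ {s(q, p)} = (a \ {s(q, p)}) ∆ (M \ {s(q, p)}) := symmDiff_sdiff_eq a M _
    have key0 := not_reachable_iff_sdiff_star (ω := a) (S := S) (T := T) hF
    have key1 := not_reachable_iff_sdiff_star (ω := a ∆ M) (S := S) (T := T) hF
    -- the extra clause of the star lemma is vacuous: `t' ∈ T` is never joined to `S` off the pair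
    have hB0 : (∀ s ∈ S, ∀ t ∈ T, ¬ (openGraph (a)).Reachable s t) ↔ (∀ s ∈ S, ∀ t ∈ T, ¬ (openGraph (a \ {s(q, p)})).Reachable s t) := by
      rw [key0]; exact ⟨fun h => h.1, fun h => ⟨h, fun ⟨s, hs, hr⟩ => (h s hs q hq hr).elim⟩⟩
    have hB1 : (∀ s ∈ S, ∀ t ∈ T, ¬ (openGraph (a ∆ M)).Reachable s t) ↔ (∀ s ∈ S, ∀ t ∈ T, ¬ (openGraph ((a ∆ M) \ {s(q, p)})).Reachable s t) := by
      rw [key1]; exact ⟨fun h => h.1, fun h => ⟨h, fun ⟨s, hs, hr⟩ => (h s hs q hq hr).elim⟩⟩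
    have := cond_transfer S T T N subset_rfl Φ hΦ hFtouch hB0 hB1
    rw [hx1] at this
    exact this

/-- **Pair INSIDE `T`, doubly-open coordinate**: for `e ∈ u` with both endpoints in `T`, `K(T, N, M, u) = K(T, N, M, u \ {e})`. [folklore] -/
theorem count_inside_u (S T N : Set V) (Φ : BondConfig V → BondConfig V → Prop)
    (hΦ : ∀ a a' b b' : BondConfig V, (⋃ s ∈ S, openEdgeCluster (a) s) = (⋃ s ∈ S, openEdgeCluster (a') s) → (⋃ s ∈ S, openEdgeCluster (b) s) = (⋃ s ∈ S, openEdgeCluster (b') s) → (Φ a b ↔ Φ a' b'))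
    (M u : BondConfig V) (huM : Disjoint u M) {p q : V} (hp : p ∈ T) (hq : q ∈ T) (he : s(q, p) ∈ u) :
    (Finset.univ.filter fun a : BondConfig V => a \ (M) = u ∧ ((∀ w ∈ N, ¬ ((∃ s ∈ S, (openGraph (a)).Reachable s w) ∧ (∃ s ∈ S, (openGraph (a ∆ (M))).Reachable s w))) ∧ (∀ s ∈ S, ∀ t ∈ T, ¬ (openGraph (a)).Reachable s t) ∧ (∀ s ∈ S, ∀ t ∈ T, ¬ (openGraph (a ∆ (M))).Reachable s t) ∧ Φ (a) (a ∆ (M)))).card = (Finset.univ.filter fun a : BondConfig V => a \ (M) = u \ {s(q, p)} ∧ ((∀ w ∈ N, ¬ ((∃ s ∈ S, (openGraph (a)).Reachable s w) ∧ (∃ s ∈ S, (openGraph (a ∆ (M))).Reachable s w))) ∧ (∀ s ∈ S, ∀ t ∈ T, ¬ (openGraph (a)).Reachable s t) ∧ (∀ s ∈ S, ∀ t ∈ T, ¬ (openGraph (a ∆ (M))).Reachable s t) ∧ Φ (a) (a ∆ (M)))).card := by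
  classical
  have hF : ∀ e ∈ ({s(q, p)} : Set (Sym2 V)), ∃ t'' ∈ T, e = s(q, t'') := by
    intro e he; rw [Set.mem_singleton_iff] at he; exact ⟨p, hp, he⟩
  have hFtouch : ({s(q, p)} : Set (Sym2 V)) ⊆ {e : Sym2 V | ∃ t ∈ T, t ∈ e} := by
    intro e he; rw [Set.mem_singleton_iff] at he; subst he; exact ⟨p, hp, Sym2.mem_mk_right q p⟩
  have hFu : ({s(q, p)} : Set (Sym2 V)) ⊆ u := Set.singleton_subset_iff.2 he
  have hFM : Disjoint ({s(q, p)} : Set (Sym2 V)) M := huM.mono_left hFu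
  suffices key : ∀ a : BondConfig V, a \ M = u →
      (((∀ w ∈ N, ¬ ((∃ s ∈ S, (openGraph (a)).Reachable s w) ∧ (∃ s ∈ S, (openGraph (a ∆ M)).Reachable s w))) ∧ (∀ s ∈ S, ∀ t ∈ T, ¬ (openGraph (a)).Reachable s t) ∧ (∀ s ∈ S, ∀ t ∈ T, ¬ (openGraph (a ∆ M)).Reachable s t) ∧ Φ (a) (a ∆ M)) ↔ ((∀ w ∈ N, ¬ ((∃ s ∈ S, (openGraph (a \ {s(q, p)})).Reachable s w) ∧ (∃ s ∈ S, (openGraph ((a \ {s(q, p)}) ∆ M)).Reachable s w))) ∧ (∀ s ∈ S, ∀ t ∈ T, ¬ (openGraph (a \ {s(q, p)})).Reachable s t) ∧ (∀ s ∈ S, ∀ t ∈ T, ¬ (openGraph ((a \ {s(q, p)}) ∆ M)).Reachable s t) ∧ Φ (a \ {s(q, p)}) ((a \ {s(q, p)}) ∆ M))) by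
    have h := card_filter_fibre_forced M u {s(q, p)} hFu huM (fun a => ((∀ w ∈ N, ¬ ((∃ s ∈ S, (openGraph (a)).Reachable s w) ∧ (∃ s ∈ S, (openGraph (a ∆ M)).Reachable s w))) ∧ (∀ s ∈ S, ∀ t ∈ T, ¬ (openGraph (a)).Reachable s t) ∧ (∀ s ∈ S, ∀ t ∈ T, ¬ (openGraph (a ∆ M)).Reachable s t) ∧ Φ (a) (a ∆ M)))
      (fun x => ((∀ w ∈ N, ¬ ((∃ s ∈ S, (openGraph (x)).Reachable s w) ∧ (∃ s ∈ S, (openGraph (x ∆ M)).Reachable s w))) ∧ (∀ s ∈ S, ∀ t ∈ T, ¬ (openGraph (x)).Reachable s t) ∧ (∀ s ∈ S, ∀ t ∈ T, ¬ (openGraph (x ∆ M)).Reachable s t) ∧ Φ (x) (x ∆ M))) key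
    convert h using 3
  intro a ha
  have hx1 : (a ∆ M) \ {s(q, p)} = (a \ {s(q, p)}) ∆ M := by
    rw [symmDiff_sdiff_eq, sdiff_eq_left.2 hFM.symm]
  have key0 := not_reachable_iff_sdiff_star (ω := a) (S := S) (T := T) hF
  have key1 := not_reachable_iff_sdiff_star (ω := a ∆ M) (S := S) (T := T) hF
  have hB0 : (∀ s ∈ S, ∀ t ∈ T, ¬ (openGraph (a)).Reachable s t) ↔ (∀ s ∈ S, ∀ t ∈ T, ¬ (openGraph (a \ {s(q, p)})).Reachable s t) := by
    rw [key0]; exact ⟨fun h => h.1, fun h => ⟨h, fun ⟨s, hs, hr⟩ => (h s hs q hq hr).elim⟩⟩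
  have hB1 : (∀ s ∈ S, ∀ t ∈ T, ¬ (openGraph (a ∆ M)).Reachable s t) ↔ (∀ s ∈ S, ∀ t ∈ T, ¬ (openGraph ((a ∆ M) \ {s(q, p)})).Reachable s t) := by
    rw [key1]; exact ⟨fun h => h.1, fun h => ⟨h, fun ⟨s, hs, hr⟩ => (h s hs q hq hr).elim⟩⟩
  have := cond_transfer S T T N subset_rfl Φ hΦ hFtouch hB0 hB1
  rw [hx1] at this
  exact this

/-- **Isolated `T`**: if no live coordinate meets `T` and `S ∩ T = ∅`, the `T`-conditions are automatic: `K(T, …) = K(∅, …)`. [folklore] -/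
theorem count_isolated (S T N : Set V) (Φ : BondConfig V → BondConfig V → Prop)
    (M u : BondConfig V) (hiso : ∀ e ∈ M ∪ u, ¬ ∃ t ∈ T, t ∈ e) (hST : Disjoint S T) :
    (Finset.univ.filter fun a : BondConfig V => a \ (M) = u ∧ ((∀ w ∈ N, ¬ ((∃ s ∈ S, (openGraph (a)).Reachable s w) ∧ (∃ s ∈ S, (openGraph (a ∆ (M))).Reachable s w))) ∧ (∀ s ∈ S, ∀ t ∈ T, ¬ (openGraph (a)).Reachable s t) ∧ (∀ s ∈ S, ∀ t ∈ T, ¬ (openGraph (a ∆ (M))).Reachable s t) ∧ Φ (a) (a ∆ (M)))).card = (Finset.univ.filter fun a : BondConfig V => a \ (M) = u ∧ ((∀ w ∈ N, ¬ ((∃ s ∈ S, (openGraph (a)).Reachable s w) ∧ (∃ s ∈ S, (openGraph (a ∆ (M))).Reachable s w))) ∧ (∀ s ∈ S, ∀ t ∈ (∅ : Set V), ¬ (openGraph (a)).Reachable s t) ∧ (∀ s ∈ S, ∀ t ∈ (∅ : Set V), ¬ (openGraph (a ∆ (M))).Reachable s t) ∧ Φ (a) (a ∆ (M)))).card := by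
  classical
  -- on the fibre, a copy only uses pairs of `M ∪ u`, none of which meets `T`
  have hB : ∀ a : BondConfig V, a ⊆ M ∪ u → (∀ s ∈ S, ∀ t ∈ T, ¬ (openGraph (a)).Reachable s t) := by
    intro a haMu s hs t ht hst
    rw [SimpleGraph.reachable_iff_reflTransGen] at hst
    have key : ∀ w, Relation.ReflTransGen (openGraph a).Adj s w → w ∈ T → False := by
      intro w hw
      induction hw with
      | refl => exact fun hsT => Set.disjoint_left.1 hST hs hsT
      | @tail b c _ hbc _ =>
        intro hcT
        obtain ⟨hω, _⟩ := (openGraph_adj a b c).1 hbc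
        exact hiso _ (haMu hω) ⟨c, hcT, Sym2.mem_mk_right b c⟩
    exact key t hst ht
  have hsub : ∀ a : BondConfig V, a \ M = u → a ⊆ M ∪ u := by
    intro a ha e he
    by_cases heM : e ∈ M
    · exact Or.inl heM
    · exact Or.inr (by rw [← ha]; exact ⟨he, heM⟩)
  have hsub1 : ∀ a : BondConfig V, a \ M = u → a ∆ M ⊆ M ∪ u := by
    intro a ha e he
    rcases Set.mem_symmDiff.1 he with ⟨hea, _⟩ | ⟨heM, _⟩
    · exact hsub a ha hea
    · exact Or.inl heM
  congr 1
  refine Finset.filter_congr fun a _ => ?_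
  constructor
  · rintro ⟨ha, hHC, -, -, hΦ'⟩
    exact ⟨ha, hHC, fun s _ t ht _ => ht.elim, fun s _ t ht _ => ht.elim, hΦ'⟩
  · rintro ⟨ha, hHC, -, -, hΦ'⟩
    exact ⟨ha, hHC, hB a (hsub a ha), hB (a ∆ M) (hsub1 a ha), hΦ'⟩

/-- If `S` meets `T`, no configuration satisfies the `T`-condition: `K(T, …) = 0`. [folklore] -/
theorem count_eq_zero_of_not_disjoint (S T N : Set V) (Φ : BondConfig V → BondConfig V → Prop)
    (M u : BondConfig V) (hST : ¬ Disjoint S T) : (Finset.univ.filter fun a : BondConfig V => a \ (M) = u ∧ ((∀ w ∈ N, ¬ ((∃ s ∈ S, (openGraph (a)).Reachable s w) ∧ (∃ s ∈ S, (openGraph (a ∆ (M))).Reachable s w))) ∧ (∀ s ∈ S, ∀ t ∈ T, ¬ (openGraph (a)).Reachable s t) ∧ (∀ s ∈ S, ∀ t ∈ T, ¬ (openGraph (a ∆ (M))).Reachable s t) ∧ Φ (a) (a ∆ (M)))).card = 0 := by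
  classical
  rw [Finset.card_eq_zero, Finset.filter_eq_empty_iff]
  rintro a - ⟨-, -, hB, -, -⟩
  obtain ⟨s, hsS, hsT⟩ := Set.not_disjoint_iff.1 hST
  exact hB s hsS s hsT (SimpleGraph.Reachable.refl s)

end Cases

end Consts.HardCoreReduction

end Summit.CriticalPhenomena.PercolationContinuityZ3.Theorems
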